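import Summits.ABC.IUTFork.Thm311RealInd1StripPacketMonomialBoxSharpRoom
import Literature.IUT.LogVolume.PacketDualBasisBox
import HarnessLib

/-!
# [IUTchIII] Thm 3.11 (i) (Ind1)+(Ind2), genuine packet of TAME factors of ARBITRARY residue degrees: the factorwise-strip orbit of the Θ-region
# `ι_{i₀}(g)·(R_I)^∼` is CONFINED to the polydisc of radius `p^{−v/E}·∏_{i∈S} p^{1−1/e_i}·∏_{i∉S} p^{1−2/e_i}` when the bits fail off `S`, residue degree
# ONE being required ONLY off `S` (UNCONDITIONAL) — via the DUAL-BASIS BOX `(R_I)^∼ = Box` of Literature `PacketDualBasisBox`; hence the room inequality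
# is SHARP at every factor count, every residue and EVERY MIX OF RESIDUE DEGREES

PROOF-ONLY file (abc-iut cell, Cor. 3.12 sub-crew, seat abc-iut-c312-1 = holder of record of the typed [IUTchIII] Thm. 3.11, gen 20; row offer (λ) «factors with
f > 1 in the converse», C LEAD abc-iut-plan; sequel of gen 19's `Thm311RealInd1StripPacketMonomialBoxSharp` / `…SharpRoom` (row R27)).  TAKES NO SIDE on
[IUTchIII] Cor. 3.12.  No definition, no `Prop` fact, NO `JannsenWingbergMappingClass`: everything UNCONDITIONAL (failing bits = displayed `hfix` binders off `S`).
SETTING.  Genuine packet `X = ⊗_{i∈I} K_{w_i}`, EVERY factor TAME (`p > 2`, `e_i ≤ p − 2`) of ANY residue degree `f_i`; slot `i₀`, `‖g‖ = p^{−v/E}`; `S ⊆ I` the factors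
where NO bit hypothesis is made (a bit may hold there, or `f_i > 1` — the identity side, R25 (A) `…_eq_of_bitsOn_…`, displays a bit only at full-depth factors of
residue degree ONE, so factors with `f_i > 1` belong to `S` on both sides); off `S`: residue degree one, `e_i ≥ 2`, and the bit FAILS (`hfix`); `H ≤ Aut_{ℚ_p}(X)`
factorwise through the realised strip groups (p554348 §2).
MECHANISM.  Gen 19's engine with the radical power basis REPLACED by a norm-unimodular trace-dual pair `(b^{(i)}, d^{(i)})` of each tame slot (abc-iut-E-t42
`TameDualPair.exists_normUnimodular_dualPair_of_not_wild`, any residue degree), at which `(R_I)^∼ = Box(b)` (Literature `PacketDualBasisBox`: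
`MonomialBox.exists_dualPair_mem_normalizedPacket_iff_box_of_not_dvd_absRamificationIdx` — [IUTchIV] Prop. 1.1 coordinatewise); basis norms `‖b^{(i)}_m‖ = p^{−t/e_i}`
(value group, S1 `exists_norm_eq_rpow`); per exponent a strip-stable radius with uniform gain (§1); ultrametric summation over the tensor basis (§2).
* §1 **`exists_stableRadius_of_imp`** — one tame place, `bit : Prop`; residue degree one and `e ≥ 2` are asked ONLY IF THE BIT MAY FAIL (`¬bit → f = 1`,
  `¬bit → 2 ≤ e`): for every `t ∈ ℤ` a strip-stable radius `ρ` with `p^{−t/e} ≤ ρ ≤ p^{−t/e}·p^{1−1/e−[¬bit]/e}` (may-hold branch: log-shell balls `p^q·log_p`, strip-stable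
  at EVERY place — p554348 §1 / R25 (B) `norm_of_apply_le_of_mem_closure_of_le`; failing branch: gen 19's `exists_stableRadius` BY NAME).
* §2 **`packetHull_orbit_smul_normalizedPacket_subset_polydisc_of_fixesBaseLine_off_mixed`** — hull(`H`-orbit of `ι_{i₀}(g)·(R_I)^∼`) ⊆ polydisc(`R′_S`),
  `R′_S = ∏_i p^{−[i=i₀]v/e_i + 1 − 1/e_i − [i∉S]/e_i}` — the SAME radius as gen 19's residue-degree-one theorem, now for tame factors of ANY residue degrees on `S`
  (gen 19's `…_fixesBaseLine_off` (p566812) is the instance «`f_i = 1`, `e_i ≥ 2` at every factor» — same statement, not re-declared).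
* §3 **`packetHull_orbit_ne_container_of_not_room_mixed`** — bits only on `S` (off `S`: `f_i = 1`, `e_i ≥ 2`, bit fails) + R25 (A) §2's room inequality FAILING
  (VERBATIM, negated) ⟹ the hull is NOT the container `packetHull(p^{A}·log_p(R_I^×))` — at EVERY factor count, EVERY residue `r` and EVERY mix of residue degrees
  (gen 19's `prodRadius_lt_container_of_not_room` + R25 (B′) §5 `packetHull_ne_of_subset_polydisc_of_lt` BY NAME).  With R25 (A) §2 (bits on `S` + room ⟹ identity,
  mod hMC; factors with `f_i > 1` at full depth need NO bit) the room inequality with `S ⊇ {i : f_i > 1}` is the EXACT threshold of the junction identity at tame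
  packets of ARBITRARY residue degrees: the «`f > 1` outside» clause of R26/R27's honest scope is REMOVED on the converse side.
READING (numbers about OUR typed objects; neutral); which value a bit takes is NOT claimed; HONEST SCOPE: unconditional; all factors tame (`p > 2`, `e_i ≤ p − 2`);
residue degree one + `e_i ≥ 2` off `S` only; OUR typings (THE equivariant lift, THE logarithm, factorwise action; F-B28-1 untouched); EVEN degree (identity side), WILD,
`p = 2` outside; equal-AS-TYPED ≠ equal in print; nothing here asserts that abc is proved or refuted; no side taken on [IUTchIII] Cor. 3.12 / [IUTchIV] Thm. 1.10, on
(U) vs (P), or on any author. [claim: Mochizuki2012, status: disputed]; [cite: Mochizuki2012, IUTchIII Thm. 3.11 (i) p. 154; Rmk. 3.9.5 (i) p. 127; Cor. 3.12 Step (xi)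
p. 183; IUTchIV Prop. 1.1 p. 9, Prop. 1.2 (ii) pp. 10–11, Prop. 1.4 (i) p. 13]; [cite: DupuyHilado2025, §4.9, §4.12]; [cite: SerreLocalFields1979, Ch. III §3, Prop. 7].
typed ≠ proved.
-/

set_option autoImplicit false

noncomputable section

open Metric Set Bornology Function Module
open scoped Pointwise TensorProduct NormedField

namespace Summit.ABC.IUTFork.Thm311.Real

open NumberField IsDedekindDomain Literature.NumberTheory.NumberFields Literature.IUT.LogVolume
open Literature.NumberTheory.GaloisRepresentations Literature.NumberTheory.GaloisRepresentations.Ultrametric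
open Literature.AnabelianGeometry.AbsoluteAnabelian Literature.IUT.HodgeArakelov
open Literature.IUT.HodgeArakelov.AbsTopMonoids

variable {K : Type} [Field K] [NumberField K] (p : ℕ) [hp : Fact p.Prime]

/-! ## §1 One place: strip-stable radii with uniform gain; residue degree one only where the bit may fail -/

/-- **Strip-stable radii with uniform gain, residue degree one asked ONLY where the bit may fail (UNCONDITIONAL).**  At a tame place `v` (`p > 2`, `e ≤ p − 2`) let
`bit : Prop`; IF the bit may fail we ask residue degree one, `e ≥ 2` and `hfix`.  For every `t ∈ ℤ` there is a radius `ρ` with `p^{−t/e} ≤ ρ`, mapped into itself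
by the whole realised strip GROUP, and `ρ ≤ p^{−t/e}·p^{1−1/e}` if the bit may hold (the log-shell balls `p^{⌊t/e⌋}·log_p`, resp. `p^{t/e−1}·log_p` when `e ∣ t`:
strip-stable at EVERY place, R25 (B) `norm_of_apply_le_of_mem_closure_of_le`), `ρ ≤ p^{−t/e}·p^{1−2/e}` if it fails (gen 19's `exists_stableRadius` BY NAME).
[claim: Mochizuki2012, status: disputed] [cite: Mochizuki2012, IUTchIII Thm. 3.11 (i) p. 154; Rmk. 3.9.5 (i) p. 127] -/
theorem exists_stableRadius_of_imp (v : HeightOneSpectrum (𝓞 K)) (hv : ((p : ℕ) : 𝓞 K) ∈ v.asIdeal) (hp2 : 2 < p)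
    (he : absRamificationIdx p (RescaledCompletion K p v hv) ≤ p - 2) (bit : Prop) [Decidable bit]
    (he2 : ¬ bit → 2 ≤ absRamificationIdx p (RescaledCompletion K p v hv)) (hf : ¬ bit → v.asIdeal.inertiaDeg ℤ = 1)
    (hfix : ¬ bit → ∀ ψ ∈ ind1StripOf v (galoisLog v),
      RescaledCompletion.of K p v hv (ψ (p : v.adicCompletion K)) - (p : RescaledCompletion K p v hv) ∈
        (p : ℚ_[p]) • logUnits (RescaledCompletion K p v hv))
    (t : ℤ) :
    ∃ ρ : ℝ, (p : ℝ) ^ (-((t : ℝ) / (absRamificationIdx p (RescaledCompletion K p v hv) : ℝ))) ≤ ρ ∧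
      (∀ δ ∈ AddSubgroup.closure (G := AddAut (v.adicCompletion K)) (ind1StripOf v (galoisLog v)),
        ∀ y : v.adicCompletion K, ‖RescaledCompletion.of K p v hv y‖ ≤ ρ → ‖RescaledCompletion.of K p v hv (δ y)‖ ≤ ρ) ∧
      ρ ≤ (p : ℝ) ^ (-((t : ℝ) / (absRamificationIdx p (RescaledCompletion K p v hv) : ℝ)) +
        (1 - 1 / (absRamificationIdx p (RescaledCompletion K p v hv) : ℝ) - if bit then 0 else 1 / (absRamificationIdx p (RescaledCompletion K p v hv) : ℝ))) := by
  by_cases hb : bit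
  swap
  · exact exists_stableRadius p v hv hp2 he (he2 hb) (hf hb) bit hfix t
  -- the bit may hold: log-shell balls, no residue hypothesis
  rw [if_pos hb]
  set E : ℕ := absRamificationIdx p (RescaledCompletion K p v hv) with hE
  have hP : p.Prime := Fact.out
  have hp0 : (0 : ℝ) < p := by exact_mod_cast hP.pos
  have hp1 : (1 : ℝ) ≤ p := by exact_mod_cast hP.one_lt.le
  have hpQ : (p : ℚ_[p]) ≠ 0 := by exact_mod_cast hP.ne_zero
  have hE0 : (0 : ℝ) < (E : ℝ) := by exact_mod_cast absRamificationIdx_pos p (RescaledCompletion K p v hv)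
  have hE1r : (1 : ℝ) ≤ (E : ℝ) := by exact_mod_cast absRamificationIdx_pos p (RescaledCompletion K p v hv)
  have hEz : (0 : ℤ) < (E : ℤ) := by exact_mod_cast absRamificationIdx_pos p (RescaledCompletion K p v hv)
  have hnp : ∀ q : ℤ, ‖(p : ℚ_[p]) ^ q‖ = (p : ℝ) ^ (-(q : ℝ)) := fun q => by
    rw [norm_zpow, Padic.norm_p, inv_zpow', ← Real.rpow_intCast, Int.cast_neg]
  set q : ℤ := t / (E : ℤ) with hq
  set r : ℤ := t % (E : ℤ) with hr
  have hr0 : 0 ≤ r := Int.emod_nonneg _ hEz.ne'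
  have hrE : r < E := Int.emod_lt_of_pos _ hEz
  have htqr : (t : ℝ) = (E : ℝ) * q + r := by
    have h1 : t = (E : ℤ) * q + r := by rw [hr, hq, Int.emod_def]; ring
    exact_mod_cast h1
  have htE : (t : ℝ) / (E : ℝ) = q + (r : ℝ) / (E : ℝ) := by rw [htqr]; field_simp
  have h1E : (1 : ℝ) / (E : ℝ) ≤ 1 := by rw [div_le_one hE0]; exact hE1r
  have h0E : (0 : ℝ) ≤ 1 / (E : ℝ) := by positivity
  by_cases hdiv : r = 0
  · -- `e ∣ t`: the log-shell ball `p^{q−1}·log_p`, radius `p^{−q+1−1/E}`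
    have htE0 : (t : ℝ) / (E : ℝ) = q := by simp [htE, hdiv]
    refine ⟨‖(p : ℚ_[p]) ^ (q - 1)‖ * (p : ℝ) ^ (-(1 / (E : ℝ))), ?_, fun δ hδ y hy => ?_, ?_⟩
    · rw [hnp, ← Real.rpow_add hp0]
      refine Real.rpow_le_rpow_of_exponent_le hp1 ?_
      rw [htE0]; push_cast; linarith
    · exact norm_of_apply_le_of_mem_closure_of_le p v hv hp2 he (zpow_ne_zero _ hpQ) hδ hy
    · rw [hnp, ← Real.rpow_add hp0]
      refine Real.rpow_le_rpow_of_exponent_le hp1 ?_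
      rw [htE0]; push_cast; linarith
  · -- `e ∤ t`: the log-shell ball `p^{q}·log_p`, radius `p^{−q−1/E}`
    have hr1 : 1 ≤ r := by omega
    have hr1' : (1 : ℝ) ≤ (r : ℝ) := by exact_mod_cast hr1
    have hrE' : (r : ℝ) ≤ (E : ℝ) - 1 := by
      have : r ≤ (E : ℤ) - 1 := by omega
      exact_mod_cast this
    refine ⟨‖(p : ℚ_[p]) ^ q‖ * (p : ℝ) ^ (-(1 / (E : ℝ))), ?_, fun δ hδ y hy => ?_, ?_⟩
    · rw [hnp, ← Real.rpow_add hp0]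
      refine Real.rpow_le_rpow_of_exponent_le hp1 ?_
      rw [htE]
      have : (1 : ℝ) / (E : ℝ) ≤ (r : ℝ) / (E : ℝ) := div_le_div_of_nonneg_right hr1' hE0.le
      linarith
    · exact norm_of_apply_le_of_mem_closure_of_le p v hv hp2 he (zpow_ne_zero _ hpQ) hδ hy
    · rw [hnp, ← Real.rpow_add hp0]
      refine Real.rpow_le_rpow_of_exponent_le hp1 ?_
      rw [htE]
      have h1 : (r : ℝ) / (E : ℝ) ≤ 1 - 1 / (E : ℝ) := by
        rw [div_le_iff₀ hE0, sub_mul, one_mul, div_mul_cancel₀ _ hE0.ne']; linarith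
      linarith

/-! ## §2 Any number of tame factors of any residue degrees: confinement of the orbit of the Θ-region by the dual-basis box -/

section Packet

variable {I : Type} [Fintype I] [DecidableEq I] (w : I → HeightOneSpectrum (𝓞 K)) (hw : ∀ i, ((p : ℕ) : 𝓞 K) ∈ (w i).asIdeal)

/-- **CONFINEMENT OF THE Θ-REGION's ORBIT AT TAME PACKETS OF ANY RESIDUE DEGREES (UNCONDITIONAL, any number of factors).**  Genuine packet, every factor tame;
`‖g‖ = p^{−v/E}`; on `S` NO hypothesis (a bit may hold, or `f_i > 1`); off `S`: residue degree one, `e_i ≥ 2`, and the bit FAILS (`hfix`); `H` factorwise through the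
realised strip groups.  Then the `(R_I)^∼`-hull of the `H`-orbit of `ι_{i₀}(g)·(R_I)^∼` lies in the polydisc of radius `R′_S = ∏_i p^{−[i=i₀]·v/e_i + 1 − 1/e_i − [i∉S]/e_i}`:
write `z = ι_{i₀}(g)·y`, `y = Σ_J y_J ⊗_i b^{(i)}_{J_i}` in norm-unimodular trace-dual slot bases with `‖y_J‖·∏_i ‖b_{J_i}‖ ≤ 1` (`(R_I)^∼` = Box, Literature
`PacketDualBasisBox`); each `γ(⊗u_J)`, `u_J = (b_{J_i})[i₀ ↦ g·b_{J_{i₀}}]`, is a pure tensor with factor norms `≤ ρ_{J,i}` (§1 at the exponent `t` with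
`‖u_{J,i}‖ = p^{−t/e_i}`), `∏_i ρ_{J,i} ≤ (∏_i ‖b_{J_i}‖)·R′_S`; ultrametric sum over `J`. [claim: Mochizuki2012, status: disputed]
[cite: Mochizuki2012, IUTchIII Thm. 3.11 (i) p. 154; Rmk. 3.9.5 (i) p. 127; IUTchIV Prop. 1.1 p. 9, Prop. 1.2 (ii) p. 10] [cite: DupuyHilado2025, §4.9, §4.12] -/
theorem packetHull_orbit_smul_normalizedPacket_subset_polydisc_of_fixesBaseLine_off_mixed (hp2 : 2 < p)
    (he : ∀ i, absRamificationIdx p (RescaledCompletion K p (w i) (hw i)) ≤ p - 2)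
    (i₀ : I) {g : RescaledCompletion K p (w i₀) (hw i₀)} {v : ℤ}
    (hv : ‖g‖ = (p : ℝ) ^ (-(v / (absRamificationIdx p (RescaledCompletion K p (w i₀) (hw i₀)) : ℝ))))
    (S : Finset I)
    (he2 : ∀ i, i ∉ S → 2 ≤ absRamificationIdx p (RescaledCompletion K p (w i) (hw i)))
    (hf : ∀ i, i ∉ S → (w i).asIdeal.inertiaDeg ℤ = 1)
    (hfix : ∀ i, i ∉ S → ∀ ψ ∈ ind1StripOf (w i) (galoisLog (w i)),
      RescaledCompletion.of K p (w i) (hw i) (ψ (p : (w i).adicCompletion K)) - (p : RescaledCompletion K p (w i) (hw i)) ∈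
        (p : ℚ_[p]) • logUnits (RescaledCompletion K p (w i) (hw i)))
    (H : Subgroup (PacketAlgebra p (fun i => RescaledCompletion K p (w i) (hw i)) ≃ₗ[ℚ_[p]]
      PacketAlgebra p (fun i => RescaledCompletion K p (w i) (hw i))))
    (hHfac : ∀ γ ∈ H, ∃ δ : Π i, AddAut ((w i).adicCompletion K),
      (∀ i, δ i ∈ AddSubgroup.closure (G := AddAut ((w i).adicCompletion K)) (ind1StripOf (w i) (galoisLog (w i)))) ∧
      ∀ z : Π i, RescaledCompletion K p (w i) (hw i),
        γ (PiTensorProduct.tprod ℚ_[p] z) =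
          PiTensorProduct.tprod ℚ_[p] (fun i => RescaledCompletion.of K p (w i) (hw i)
            (δ i ((RescaledCompletion.of K p (w i) (hw i)).symm (z i))))) :
    packetHull p (fun i => RescaledCompletion K p (w i) (hw i))
        (⋃ γ : H, (γ : PacketAlgebra p (fun i => RescaledCompletion K p (w i) (hw i)) ≃ₗ[ℚ_[p]]
            PacketAlgebra p (fun i => RescaledCompletion K p (w i) (hw i))) ''
          (iota p (fun i => RescaledCompletion K p (w i) (hw i)) i₀ g •
            (normalizedPacket p (fun i => RescaledCompletion K p (w i) (hw i)) :
              Set (PacketAlgebra p (fun i => RescaledCompletion K p (w i) (hw i)))))) ⊆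
      dEquiv p (fun i => RescaledCompletion K p (w i) (hw i)) ⁻¹'
        polydisc (DFac p (fun i => RescaledCompletion K p (w i) (hw i))) (fun _ =>
          ∏ i, (p : ℝ) ^ (-(if i = i₀ then (v : ℝ) else 0) / (absRamificationIdx p (RescaledCompletion K p (w i) (hw i)) : ℝ) +
            (1 - 1 / (absRamificationIdx p (RescaledCompletion K p (w i) (hw i)) : ℝ) -
              if i ∈ S then 0 else 1 / (absRamificationIdx p (RescaledCompletion K p (w i) (hw i)) : ℝ)))) := by
  classical
  set k := fun i => RescaledCompletion K p (w i) (hw i) with hk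
  set em := fun i => RescaledCompletion.of K p (w i) (hw i) with hem_def
  haveI : Nonempty I := ⟨i₀⟩
  have hP : p.Prime := Fact.out
  have hp0 : (0 : ℝ) < p := by exact_mod_cast hP.pos
  have hei0 : ∀ i, (0 : ℝ) < (absRamificationIdx p (k i) : ℝ) := fun i => by exact_mod_cast absRamificationIdx_pos p (k i)
  -- gains and the target radius
  let gain : I → ℝ := fun i => 1 - 1 / (absRamificationIdx p (k i) : ℝ) - if i ∈ S then 0 else 1 / (absRamificationIdx p (k i) : ℝ)
  let sh : I → ℝ := fun i => if i = i₀ then (v : ℝ) else 0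
  set R' : ℝ := ∏ i, (p : ℝ) ^ (-(sh i) / (absRamificationIdx p (k i) : ℝ) + gain i) with hR'
  have hR'0 : 0 ≤ R' := Finset.prod_nonneg fun i _ => (Real.rpow_pos_of_pos hp0 _).le
  -- tameness `p ∤ e_i`
  have hpe : ∀ i, ¬ p ∣ absRamificationIdx p (k i) := fun i hd => by
    have h1 := Nat.le_of_dvd (absRamificationIdx_pos p (k i)) hd
    have h2 : absRamificationIdx p (k i) ≤ p - 2 := he i
    have h3 := hP.two_le; omega
  -- the dual-basis box: norm-unimodular trace-dual slot bases with `(R_I)^∼ = Box`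
  obtain ⟨n, b, d, -, -, -, hiff⟩ := MonomialBox.exists_dualPair_mem_normalizedPacket_iff_box_of_not_dvd_absRamificationIdx p k hpe
  have hbox : ∀ y ∈ normalizedPacket p k, ∀ J : Π i, Fin (n i),
      ‖(Basis.piTensorProduct b).repr y J‖ * ∏ i, ‖b i (J i)‖ ≤ 1 := fun y hy J => (hiff y).mp hy J
  -- basis norms `‖b^{(i)}_j‖ = p^{−tb/e_i}` (value group)
  have hnbex : ∀ i (j : Fin (n i)), ∃ m : ℤ, ‖b i j‖ = (p : ℝ) ^ (-(m / (absRamificationIdx p (k i) : ℝ))) := fun i j =>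
    exists_norm_eq_rpow p (k i) ((b i).ne_zero j)
  choose tb htb using hnbex
  -- (§1) strip-stable radii for every factor and exponent, `t = tb + [i = i₀]·v`
  let tt : (i : I) → Fin (n i) → ℤ := fun i j => tb i j + (if i = i₀ then v else 0)
  have htcast : ∀ i (j : Fin (n i)), ((tt i j : ℤ) : ℝ) = ((tb i j : ℤ) : ℝ) + sh i := by
    intro i j; simp only [tt, sh]; split_ifs <;> push_cast <;> ring
  have hρex : ∀ i (j : Fin (n i)), ∃ ρ : ℝ,
      (p : ℝ) ^ (-(((tt i j : ℤ) : ℝ) / (absRamificationIdx p (k i) : ℝ))) ≤ ρ ∧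
      (∀ δ ∈ AddSubgroup.closure (G := AddAut ((w i).adicCompletion K)) (ind1StripOf (w i) (galoisLog (w i))),
        ∀ y : (w i).adicCompletion K, ‖em i y‖ ≤ ρ → ‖em i (δ y)‖ ≤ ρ) ∧
      ρ ≤ (p : ℝ) ^ (-(((tt i j : ℤ) : ℝ) / (absRamificationIdx p (k i) : ℝ)) + gain i) :=
    fun i j => exists_stableRadius_of_imp p (w i) (hw i) hp2 (he i) (i ∈ S) (fun hni => he2 i hni) (fun hni => hf i hni)
      (fun hni => hfix i hni) (tt i j)
  choose ρ hρlo hρst hρhi using hρex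
  have hρ0 : ∀ i j, 0 ≤ ρ i j := fun i j => (Real.rpow_pos_of_pos hp0 _).le.trans (hρlo i j)
  -- the exponent bookkeeping: `p^{−t/e} = ‖b_i j‖·p^{−sh_i/e_i}`
  have hsplit : ∀ i (j : Fin (n i)) (x : ℝ),
      (p : ℝ) ^ (-(((tt i j : ℤ) : ℝ) / (absRamificationIdx p (k i) : ℝ)) + x) =
        ‖b i j‖ * (p : ℝ) ^ (-(sh i) / (absRamificationIdx p (k i) : ℝ) + x) := by
    intro i j x
    rw [htb, ← Real.rpow_add hp0, htcast]
    congr 1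
    ring
  -- the orbit bound
  set O := ⋃ γ : H, (γ : PacketAlgebra p k ≃ₗ[ℚ_[p]] PacketAlgebra p k) ''
    (iota p k i₀ g • (normalizedPacket p k : Set (PacketAlgebra p k))) with hO
  have hOle : ∀ y' ∈ O, ∀ jj, ‖dEquiv p k y' jj‖ ≤ R' := by
    intro y' hy' jj
    obtain ⟨γ, hy''⟩ := Set.mem_iUnion.mp hy'
    obtain ⟨z, hz, rfl⟩ := hy''
    obtain ⟨y, hy, rfl⟩ := Set.mem_smul_set.mp hz
    obtain ⟨δ, hδ, hγz⟩ := hHfac γ γ.2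
    -- expansion of `ι(g)·y` along the tensor basis and the image under `γ`
    set c : (Π i, Fin (n i)) → ℚ_[p] := fun J => (Basis.piTensorProduct b).repr y J with hc
    let u : (Π i, Fin (n i)) → Π i, k i := fun J => update (fun i => b i (J i)) i₀ (g * b i₀ (J i₀))
    have hexp : (γ : PacketAlgebra p k ≃ₗ[ℚ_[p]] PacketAlgebra p k) (iota p k i₀ g • y) =
        ∑ J, c J • PiTensorProduct.tprod ℚ_[p] (fun i => em i (δ i ((em i).symm (u J i)))) := by
      conv_lhs => rw [← (Basis.piTensorProduct b).sum_repr y, smul_eq_mul, Finset.mul_sum]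
      rw [map_sum]
      refine Finset.sum_congr rfl fun J _ => ?_
      rw [mul_smul_comm, map_smul, Basis.piTensorProduct_apply, ← purePacket, iota_mul_purePacket]
      exact congrArg _ (hγz (u J))
    -- norm of each term
    have hterm : ∀ J, ‖c J • dEquiv p k (PiTensorProduct.tprod ℚ_[p] (fun i => em i (δ i ((em i).symm (u J i))))) jj‖ ≤ R' := by
      intro J
      have hcomp : ‖dEquiv p k (PiTensorProduct.tprod ℚ_[p] (fun i => em i (δ i ((em i).symm (u J i))))) jj‖ =
          ∏ i, ‖em i (δ i ((em i).symm (u J i)))‖ := by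
        have h1 := psi_purePacket_apply p k (DFac p k) (dEquiv p k) (fun i => em i (δ i ((em i).symm (u J i)))) jj
        simp only [purePacket] at h1
        rw [h1, norm_prod]
        exact Finset.prod_congr rfl fun i _ => norm_factorEmb p k (DFac p k) (dEquiv p k) i jj _
      have hfac : ∀ i, ‖em i (δ i ((em i).symm (u J i)))‖ ≤ ρ i (J i) := by
        intro i
        refine hρst i (J i) _ (hδ i) _ ?_
        rw [(em i).apply_symm_apply]
        refine le_trans (le_of_eq ?_) (hρlo i (J i))
        rw [htcast]
        by_cases hi : i = i₀
        · subst hi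
          simp only [u, update_self, sh, if_pos rfl]
          rw [norm_mul, hv, htb, ← Real.rpow_add hp0]
          congr 1
          ring
        · simp only [u, update_of_ne hi, sh, if_neg hi]
          rw [htb]
          congr 1
          ring
      rw [norm_smul, hcomp]
      calc ‖c J‖ * ∏ i, ‖em i (δ i ((em i).symm (u J i)))‖
          ≤ ‖c J‖ * ∏ i, ρ i (J i) := mul_le_mul_of_nonneg_left (Finset.prod_le_prod (fun i _ => norm_nonneg _) fun i _ => hfac i) (norm_nonneg _)
        _ ≤ ‖c J‖ * ∏ i, (‖b i (J i)‖ * (p : ℝ) ^ (-(sh i) / (absRamificationIdx p (k i) : ℝ) + gain i)) :=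
          mul_le_mul_of_nonneg_left (Finset.prod_le_prod (fun i _ => hρ0 i _) fun i _ => by rw [← hsplit]; exact hρhi i (J i)) (norm_nonneg _)
        _ = (‖c J‖ * ∏ i, ‖b i (J i)‖) * R' := by rw [Finset.prod_mul_distrib, hR', mul_assoc]
        _ ≤ 1 * R' := mul_le_mul_of_nonneg_right (hbox y hy J) hR'0
        _ = R' := one_mul _
    change ‖dEquiv p k ((γ : PacketAlgebra p k ≃ₗ[ℚ_[p]] PacketAlgebra p k) (iota p k i₀ g • y)) jj‖ ≤ R'
    rw [hexp, map_sum, Finset.sum_apply]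
    refine IsUltrametricDist.norm_sum_le_of_forall_le_of_nonneg hR'0 fun J _ => ?_
    rw [map_smul, Pi.smul_apply]
    exact hterm J
  -- hull of a bounded set
  have hObdd : IsBounded (dEquiv p k '' O) := by
    refine (isBounded_polydisc (DFac p k) (fun _ => R')).subset ?_
    rintro _ ⟨y, hy, rfl⟩
    exact (mem_polydisc (DFac p k)).mpr (hOle y hy)
  have hrad : ∀ jj, hullRadius (DFac p k) (dEquiv p k '' O) jj ≤ R' := fun jj =>
    hullRadius_le_of_nonneg (DFac p k) hR'0 (by rintro _ ⟨y, hy, rfl⟩; exact hOle y hy jj)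
  intro y hy
  rw [packetHull_eq_preimage_holomorphicHull p k (DFac p k) (dEquiv p k) hObdd, Set.mem_preimage,
    holomorphicHull_of_isBounded (DFac p k) hObdd, mem_polydisc] at hy
  exact (mem_polydisc (DFac p k)).mpr fun jj => (hy jj).trans (hrad jj)

/-! ## §3 The room inequality is sharp at every factor count, every residue and every mix of residue degrees -/

/-- **THE ROOM INEQUALITY IS SHARP AT TAME PACKETS OF ARBITRARY RESIDUE DEGREES (UNCONDITIONAL).**  Genuine packet `⊗_{i∈I} K_{w_i}` of TAME factors (`e_i ≤ p − 2`, local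
degree `≥ 2`) of ANY residue degrees; `‖g‖ = p^{−v/E}`; `S ⊆ I` carries no bit hypothesis (bits may hold there, and every factor with `f_i > 1` may be put there); off `S`:
residue degree one, `e_i ≥ 2`, and no realised strip automorphism moves `ℤ_p·p` modulo `p·log_p(𝒪^×)` (`hfix`); and R25 (A) §2's room inequality FAILS:
`¬ ( ((v−1) % E + 1)/E + Σ_{i ∈ univ ∖ S} 1/e_i ≤ 1 )`.  Then for EVERY `H ≤ Aut_{ℚ_p}(X)` acting factorwise through the realised strip groups, the `(R_I)^∼`-hull of
the `H`-orbit of `ι_{i₀}(g)·(R_I)^∼` is NOT `packetHull(p^{A}·log_p(R_I^×))` (§2 + gen 19's `prodRadius_lt_container_of_not_room` + R25 (B′) §5).  Converse of R25 (A) §2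
(bits on `S` + room ⟹ identity, mod hMC; full depth at `f_i > 1` factors needs no bit): the exact threshold at every mix of residue degrees is the room inequality with
`S ⊇ {i : f_i > 1}`. [claim: Mochizuki2012, status: disputed]
[cite: Mochizuki2012, IUTchIII Thm. 3.11 (i) p. 154; Rmk. 3.9.5 (i) p. 127; Cor. 3.12 Step (xi) p. 183; IUTchIV Prop. 1.1 p. 9, Prop. 1.2 (ii) p. 10] [cite: DupuyHilado2025, §4.9, §4.12] -/
theorem packetHull_orbit_ne_container_of_not_room_mixed (hp2 : 2 < p)
    (he : ∀ i, absRamificationIdx p (RescaledCompletion K p (w i) (hw i)) ≤ p - 2) (hd2 : ∀ i, 2 ≤ localDeg K (w i))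
    (i₀ : I) {g : RescaledCompletion K p (w i₀) (hw i₀)} {v : ℤ}
    (hv : ‖g‖ = (p : ℝ) ^ (-(v / (absRamificationIdx p (RescaledCompletion K p (w i₀) (hw i₀)) : ℝ))))
    (S : Finset I)
    (he2 : ∀ i, i ∉ S → 2 ≤ absRamificationIdx p (RescaledCompletion K p (w i) (hw i)))
    (hf : ∀ i, i ∉ S → (w i).asIdeal.inertiaDeg ℤ = 1)
    (hfix : ∀ i, i ∉ S → ∀ ψ ∈ ind1StripOf (w i) (galoisLog (w i)),
      RescaledCompletion.of K p (w i) (hw i) (ψ (p : (w i).adicCompletion K)) - (p : RescaledCompletion K p (w i) (hw i)) ∈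
        (p : ℚ_[p]) • logUnits (RescaledCompletion K p (w i) (hw i)))
    (hnotroom : ¬ ((((v - 1) % (absRamificationIdx p (RescaledCompletion K p (w i₀) (hw i₀)) : ℤ) + 1 : ℤ) : ℝ) /
        (absRamificationIdx p (RescaledCompletion K p (w i₀) (hw i₀)) : ℝ) +
      ∑ i ∈ Finset.univ \ S, (1 : ℝ) / (absRamificationIdx p (RescaledCompletion K p (w i) (hw i)) : ℝ) ≤ 1))
    (H : Subgroup (PacketAlgebra p (fun i => RescaledCompletion K p (w i) (hw i)) ≃ₗ[ℚ_[p]]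
      PacketAlgebra p (fun i => RescaledCompletion K p (w i) (hw i))))
    (hHfac : ∀ γ ∈ H, ∃ δ : Π i, AddAut ((w i).adicCompletion K),
      (∀ i, δ i ∈ AddSubgroup.closure (G := AddAut ((w i).adicCompletion K)) (ind1StripOf (w i) (galoisLog (w i)))) ∧
      ∀ z : Π i, RescaledCompletion K p (w i) (hw i),
        γ (PiTensorProduct.tprod ℚ_[p] z) =
          PiTensorProduct.tprod ℚ_[p] (fun i => RescaledCompletion.of K p (w i) (hw i)
            (δ i ((RescaledCompletion.of K p (w i) (hw i)).symm (z i))))) :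
    packetHull p (fun i => RescaledCompletion K p (w i) (hw i))
        (⋃ γ : H, (γ : PacketAlgebra p (fun i => RescaledCompletion K p (w i) (hw i)) ≃ₗ[ℚ_[p]]
            PacketAlgebra p (fun i => RescaledCompletion K p (w i) (hw i))) ''
          (iota p (fun i => RescaledCompletion K p (w i) (hw i)) i₀ g •
            (normalizedPacket p (fun i => RescaledCompletion K p (w i) (hw i)) :
              Set (PacketAlgebra p (fun i => RescaledCompletion K p (w i) (hw i)))))) ≠
      packetHull p (fun i => RescaledCompletion K p (w i) (hw i))
        (((p : ℚ_[p]) ^ ((v - 1) / (absRamificationIdx p (RescaledCompletion K p (w i₀) (hw i₀)) : ℤ) + 1 - Fintype.card I)) •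
          (logPacket p (fun i => RescaledCompletion K p (w i) (hw i)) :
            Set (PacketAlgebra p (fun i => RescaledCompletion K p (w i) (hw i))))) := by
  haveI : Nonempty I := ⟨i₀⟩
  exact packetHull_ne_of_subset_polydisc_of_lt p w hw hp2 he hd2 _ (prodRadius_lt_container_of_not_room p w hw i₀ v S hnotroom)
    (packetHull_orbit_smul_normalizedPacket_subset_polydisc_of_fixesBaseLine_off_mixed p w hw hp2 he i₀ hv S he2 hf hfix H hHfac)

end Packet

end Summit.ABC.IUTFork.Thm311.Real
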